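import Summits.MatrixMultiplication.OmegaCensus.SmallFormats.MatMul22nDeflation
import Summits.MatrixMultiplication.OmegaCensus.SmallFormats.MatMul22nDeflationMatrices
import HarnessLib

/-!
# ω-census family (a): the deflation matrices exist for every pair `(c, ν)` with `ν · c ≠ 0` (any field)

Cell `pub-omega` (unit `pub-omega-tensor`, gen 40), topic `Summits/MatrixMultiplication/OmegaCensus` (sub-folder
`SmallFormats`). Framing (verbatim): lottery ticket; floor = certified bounds/negative ranges. HONEST FRAMING: linear-algebra
plumbing completing §1 of memo DEFLATION-g40 in the `(c, n)` form used there: `MatMul22nDeflation` (p735828) deflates along matrices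
`A R = 1`; `MatMul22nDeflationMatrices` produces such matrices from any pair `(c, ν)` with `ν ⬝ᵥ c ≠ 0`; this file combines the two into
the census form: `R(⟨2,2,n⟩) + #J ≤ |ι|` for any set `J` of terms of a computation of `⟨2,2,n+1⟩` each of which has a rank-one
Y-form on the line `c` or a rank-one output on the line `ν`. Nothing here is a bound on any rank by itself; nothing on `ω`.
-/

namespace Summit.MatrixMultiplication.OmegaCensus.SmallFormats

open Finset Module Matrix
open Literature.Computability.AlgebraicComplexity
open Summit.MatrixMultiplication.OmegaCensus.RankOnePlaneCapGeneral

namespace Deflation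

variable {k : Type*} [Field k] {n : ℕ}

/-- **The `(c, ν)` form of the deflation, census version.** Let `β` be a computation of `⟨2,2,n+1⟩` on `ι` over a field, `c, ν ∈ k^{n+1}`
with `ν ⬝ᵥ c ≠ 0`, and `J` a set of terms each of which has a rank-one Y-form on the line `c` (`g_i(Y) = ∑ η_q c_j Y_{qj}`) or a rank-one
output on the line `ν` (`w_i = ω ⊗ ν`). Then `R(⟨2,2,n⟩) + #J ≤ |ι|`, and there is a computation of `⟨2,2,n⟩` on `Fin (|ι| − #J)` whose
X-forms are X-forms of `β` at indices outside `J` along an injection (so its X-marginal is `β`'s minus the classes of `J`). -/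
theorem exists_shorter_of_pair {ι : Type*} [Fintype ι] [DecidableEq ι] (β : BilinComp (mulBilin k 2 2 (n + 1)) ι)
    (c ν : Fin (n + 1) → k) (h : ν ⬝ᵥ c ≠ 0) (J : Finset ι)
    (hJ : ∀ i ∈ J, (∃ η : Fin 2 → k, ∀ Y : Matrix (Fin 2) (Fin (n + 1)) k, β.g i Y = ∑ q, ∑ j, η q * c j * Y q j) ∨
      (∃ ω : Fin 2 → k, ∀ p j, β.w i p j = ω p * ν j)) :
    ∃ (β' : BilinComp (mulBilin k 2 2 n) (Fin (Fintype.card ι - J.card))) (e : Fin (Fintype.card ι - J.card) → ι),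
      Function.Injective e ∧ (∀ a, e a ∉ J) ∧ (∀ a, β'.f a = β.f (e a)) ∧
      tensorRank (matMulTensor k 2 2 n) + J.card ≤ Fintype.card ι := by
  obtain ⟨A, R, hAR, hAc, hνR⟩ := exists_AR_of_dotProduct_ne_zero c ν h
  refine exists_shorter β A R hAR J fun i hi => ?_
  rcases hJ i hi with ⟨η, hη⟩ | ⟨ω, hω⟩
  · exact Or.inl fun Y' => g_comp_eq_zero (β.g i) A η c hη hAc Y'
  · exact Or.inr (w_mul_eq_zero (β.w i) R ω ν hω hνR)

/-- **Corollary: the X-marginal count form.** Under the hypotheses of `exists_shorter_of_pair`, `R(⟨2,2,n⟩) + #J ≤ |ι|`. -/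
theorem tensorRank_add_card_le_of_pair {ι : Type*} [Fintype ι] [DecidableEq ι] (β : BilinComp (mulBilin k 2 2 (n + 1)) ι)
    (c ν : Fin (n + 1) → k) (h : ν ⬝ᵥ c ≠ 0) (J : Finset ι)
    (hJ : ∀ i ∈ J, (∃ η : Fin 2 → k, ∀ Y : Matrix (Fin 2) (Fin (n + 1)) k, β.g i Y = ∑ q, ∑ j, η q * c j * Y q j) ∨
      (∃ ω : Fin 2 → k, ∀ p j, β.w i p j = ω p * ν j)) :
    tensorRank (matMulTensor k 2 2 n) + J.card ≤ Fintype.card ι := by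
  obtain ⟨-, -, -, -, -, h⟩ := exists_shorter_of_pair β c ν h J hJ
  exact h

end Deflation

end Summit.MatrixMultiplication.OmegaCensus.SmallFormats
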